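import Literature.MathematicalPhysics.QuantumManyBody.JelliumPairLowerBound
import HarnessLib

/-!
# The background term on `Λⁿ` through the condensate: `∫m(xⱼ)|Ψ|² = PP + QQ + 2Re PQ`

Topic `Literature/MathematicalPhysics/QuantumManyBody` (the charged Bose gas, `JelliumBoseGas.foldyLaw`).
[LiebSolovej2001, §5]: the background term `-ρ∑ⱼ m(xⱼ)`, `m(x) = ∫w(x,y)dy`, is
`-ρℓ³∑_{pq}ŵ_{0p,0q}a*_pa_q`, split by `p, q = 0` or `≠ 0` into the `ŵ_{00,00}` piece (Lemma 5.2),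
the `ŵ_{p0,00}` pieces (Lemma 5.5) and the `ŵ_{p0,q0}` piece (Lemma 5.3). On `Λⁿ = cellN`, pointwise
`Ψ = PⱼΨ + QⱼΨ` gives, for a bounded measurable weight `m` and continuous `Ψ`,

`∫_{Λⁿ} m(xⱼ)|Ψ|² = ∫_{Λⁿ} m(xⱼ)|PⱼΨ|² + ∫_{Λⁿ} m(xⱼ)|QⱼΨ|² + 2Re∫_{Λⁿ} m(xⱼ) conj(PⱼΨ) QⱼΨ`

(`background_expansion`), with `∫m(xⱼ)|PⱼΨ|² = ℓ⁻³(∫_Λ m)‖PⱼΨ‖²` (`background_PP_eq`, the dummy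
integration of `JelliumLemma52`), `∫m(xⱼ)|QⱼΨ|² ≤ (sup m)‖QⱼΨ‖²`-type control through
`diag_background_eq_toReal`, and the cross term majorized by `∫⁻ m‖PⱼΨ‖₊‖QⱼΨ‖₊`
(`abs_background_cross_le_toReal`) for the Lemma 5.5 combination.

## References

* [LiebSolovej2001] E. H. Lieb, J. P. Solovej, Commun. Math. Phys. 217 (2001) 127–163, §5 and Lemma 5.5
  (arXiv:cond-mat/0007425, pp. 11–13).
-/

noncomputable section

open MeasureTheory Set Filter Real
open scoped ENNReal NNReal Topology ComplexConjugate

namespace Literature.MathematicalPhysics.QuantumManyBody.JelliumBoseGas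

open BoseGas

variable {n : ℕ} {ℓ : ℝ}

/-- **The background term split by the condensate** [LiebSolovej2001, §5]: for a measurable weight
`|m| ≤ M_b`, a particle `j` and a continuous `Ψ`,
`∫_{Λⁿ} m(xⱼ)|Ψ|² = ∫m(xⱼ)|PⱼΨ|² + ∫m(xⱼ)|QⱼΨ|² + 2∫m(xⱼ)Re(conj(PⱼΨ)QⱼΨ)`. [cite: LiebSolovej2001, §5] -/
theorem background_expansion {m : Space → ℝ} (hm : Measurable m) {Mb : ℝ} (hMb : ∀ y, |m y| ≤ Mb)
    (j : Fin n) {Ψ : Config n → ℂ} (hΨ : Continuous Ψ) :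
    ∫ X in cellN n ℓ, m (X j) * ‖Ψ X‖ ^ 2 =
      (∫ X in cellN n ℓ, m (X j) * ‖sliceMean ℓ j Ψ X‖ ^ 2) +
        (∫ X in cellN n ℓ, m (X j) * ‖sliceFluct ℓ j Ψ X‖ ^ 2) +
        2 * ∫ X in cellN n ℓ, m (X j) * (conj (sliceMean ℓ j Ψ X) * sliceFluct ℓ j Ψ X).re := by
  have hmj : Measurable fun X : Config n => m (X j) := hm.comp (measurable_pi_apply j)
  have hPc : Continuous (sliceMean ℓ j Ψ) := continuous_sliceMean ℓ j hΨ
  have hQc : Continuous (sliceFluct ℓ j Ψ) := continuous_sliceFluct ℓ j hΨ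
  have hMb0 : 0 ≤ Mb := (abs_nonneg _).trans (hMb 0)
  -- pointwise expansion
  have hpt : ∀ X, m (X j) * ‖Ψ X‖ ^ 2 = (m (X j) * ‖sliceMean ℓ j Ψ X‖ ^ 2 +
      m (X j) * ‖sliceFluct ℓ j Ψ X‖ ^ 2) +
      2 * (m (X j) * (conj (sliceMean ℓ j Ψ X) * sliceFluct ℓ j Ψ X).re) := by
    intro X
    have e := (sliceMean_add_sliceFluct ℓ j Ψ X).symm
    have hsq : ‖sliceMean ℓ j Ψ X + sliceFluct ℓ j Ψ X‖ ^ 2 = ‖sliceMean ℓ j Ψ X‖ ^ 2 +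
        ‖sliceFluct ℓ j Ψ X‖ ^ 2 + 2 * (conj (sliceMean ℓ j Ψ X) * sliceFluct ℓ j Ψ X).re := by
      have h := norm_sq_sum_eq (Finset.univ : Finset (Fin 2)) ![sliceMean ℓ j Ψ X, sliceFluct ℓ j Ψ X]
      simp only [Fin.sum_univ_two, Matrix.cons_val_zero, Matrix.cons_val_one, re_conj_mul_self] at h
      rw [h, re_conj_mul_comm (sliceMean ℓ j Ψ X) (sliceFluct ℓ j Ψ X)]
      ring
    rw [e, hsq]; ring
  -- bounds and integrability
  obtain ⟨CP, hCP⟩ := (isCompact_closedCubeN n ℓ).exists_bound_of_continuousOn hPc.continuousOn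
  obtain ⟨CQ, hCQ⟩ := (isCompact_closedCubeN n ℓ).exists_bound_of_continuousOn hQc.continuousOn
  have h1 : IntegrableOn (fun X => m (X j) * ‖sliceMean ℓ j Ψ X‖ ^ 2) (cellN n ℓ) := by
    refine integrableOn_cellN_of_bounded (hmj.mul (hPc.measurable.norm.pow_const 2)) (C := Mb * CP ^ 2)
      fun X hX => ?_
    rw [Real.norm_eq_abs, abs_mul, abs_of_nonneg (sq_nonneg ‖sliceMean ℓ j Ψ X‖)]
    exact mul_le_mul (hMb _) (pow_le_pow_left₀ (norm_nonneg _)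
      (hCP X (cellN_subset_closedCubeN n ℓ hX)) 2) (sq_nonneg _) hMb0
  have h2 : IntegrableOn (fun X => m (X j) * ‖sliceFluct ℓ j Ψ X‖ ^ 2) (cellN n ℓ) := by
    refine integrableOn_cellN_of_bounded (hmj.mul (hQc.measurable.norm.pow_const 2)) (C := Mb * CQ ^ 2)
      fun X hX => ?_
    rw [Real.norm_eq_abs, abs_mul, abs_of_nonneg (sq_nonneg ‖sliceFluct ℓ j Ψ X‖)]
    exact mul_le_mul (hMb _) (pow_le_pow_left₀ (norm_nonneg _)
      (hCQ X (cellN_subset_closedCubeN n ℓ hX)) 2) (sq_nonneg _) hMb0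
  have h3 : IntegrableOn (fun X => 2 * (m (X j) * (conj (sliceMean ℓ j Ψ X) * sliceFluct ℓ j Ψ X).re))
      (cellN n ℓ) := by
    refine integrableOn_cellN_of_bounded ((hmj.mul (Complex.measurable_re.comp
      ((Complex.continuous_conj.measurable.comp hPc.measurable).mul hQc.measurable))).const_mul 2)
      (C := 2 * (Mb * (CP * CQ))) fun X hX => ?_
    rw [Real.norm_eq_abs, abs_mul, abs_two, abs_mul]
    refine mul_le_mul_of_nonneg_left (mul_le_mul (hMb _) ((abs_re_conj_mul_le _ _).trans
      (mul_le_mul (hCP X (cellN_subset_closedCubeN n ℓ hX)) (hCQ X (cellN_subset_closedCubeN n ℓ hX))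
        (norm_nonneg _) ((norm_nonneg _).trans (hCP X (cellN_subset_closedCubeN n ℓ hX)))))
      (abs_nonneg _) hMb0) zero_le_two
  have h12 : IntegrableOn (fun X => m (X j) * ‖sliceMean ℓ j Ψ X‖ ^ 2 +
      m (X j) * ‖sliceFluct ℓ j Ψ X‖ ^ 2) (cellN n ℓ) := h1.add h2
  simp_rw [hpt]
  rw [integral_add h12 h3, integral_add h1 h2, integral_const_mul]

/-- **The condensate piece of the background**: for a measurable weight `0 ≤ m ≤ M_b` and continuous `Ψ`,
`∫_{Λⁿ} m(xⱼ)|PⱼΨ|² = ℓ⁻³(∫_Λ m)‖PⱼΨ‖²` (dummy integration; `⟨a*₀a₀⟩`-term, `ℓ⁻³∫_Λm = ℓ³ŵ_{00,00}`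
for `m = ∫w(·,y)dy`). [cite: LiebSolovej2001, Lemma 5.2] -/
theorem background_PP_eq (hℓ : 0 < ℓ) {m : Space → ℝ} (hm : Measurable m) (hm0 : ∀ y, 0 ≤ m y)
    {Mb : ℝ} (hMb : ∀ y, |m y| ≤ Mb) (j : Fin n) {Ψ : Config n → ℂ} (hΨ : Continuous Ψ) :
    ∫ X in cellN n ℓ, m (X j) * ‖sliceMean ℓ j Ψ X‖ ^ 2 =
      (ℓ ^ 3)⁻¹ * (∫ y in cell ℓ, m y) * (∫⁻ X in cellN n ℓ, (‖sliceMean ℓ j Ψ X‖₊ : ℝ≥0∞) ^ 2).toReal := by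
  have hPc : Continuous (sliceMean ℓ j Ψ) := continuous_sliceMean ℓ j hΨ
  have hmj : Measurable fun X : Config n => m (X j) := hm.comp (measurable_pi_apply j)
  have hMb0 : 0 ≤ Mb := (abs_nonneg _).trans (hMb 0)
  obtain ⟨CP, hCP⟩ := (isCompact_closedCubeN n ℓ).exists_bound_of_continuousOn hPc.continuousOn
  have hint : IntegrableOn (fun X => m (X j) * ‖sliceMean ℓ j Ψ X‖ ^ 2) (cellN n ℓ) := by
    refine integrableOn_cellN_of_bounded (hmj.mul (hPc.measurable.norm.pow_const 2)) (C := Mb * CP ^ 2)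
      fun X hX => ?_
    rw [Real.norm_eq_abs, abs_mul, abs_of_nonneg (sq_nonneg ‖sliceMean ℓ j Ψ X‖)]
    exact mul_le_mul (hMb _) (pow_le_pow_left₀ (norm_nonneg _)
      (hCP X (cellN_subset_closedCubeN n ℓ hX)) 2) (sq_nonneg _) hMb0
  -- to `ℝ≥0∞`
  rw [integral_eq_lintegral_of_nonneg_ae (Eventually.of_forall fun X => mul_nonneg (hm0 _) (sq_nonneg _))
    hint.aestronglyMeasurable]
  have e1 : ∀ X, ENNReal.ofReal (m (X j) * ‖sliceMean ℓ j Ψ X‖ ^ 2) =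
      ENNReal.ofReal (m (X j)) * (‖sliceMean ℓ j Ψ X‖₊ : ℝ≥0∞) ^ 2 := fun X => by
    rw [ENNReal.ofReal_mul (hm0 _), ← ofReal_norm_sq_eq]
  simp_rw [e1]
  -- dummy integration in `xⱼ`
  have hg : Measurable (Function.uncurry fun (_ : Config n) (y : Space) => ENNReal.ofReal (m y)) :=
    ENNReal.measurable_ofReal.comp (hm.comp measurable_snd)
  rw [lintegral_cellN_weight_of_update_invariant hℓ j (g := fun _ y => ENNReal.ofReal (m y)) hg
    (fun _ _ _ => rfl) hPc.measurable (fun X z => sliceMean_update ℓ j Ψ X z),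
    lintegral_const_mul _ (hPc.measurable.nnnorm.coe_nnreal_ennreal.pow_const _), ← mul_assoc,
    ENNReal.toReal_mul, ENNReal.toReal_mul, ENNReal.toReal_inv, ENNReal.toReal_pow,
    ENNReal.toReal_ofReal hℓ.le]
  congr 2
  -- `(∫⁻ ofReal m).toReal = ∫ m`
  have hmi : IntegrableOn m (cell ℓ) := integrableOn_cell_of_bounded hm hMb ℓ
  rw [integral_eq_lintegral_of_nonneg_ae (Eventually.of_forall hm0) hmi.aestronglyMeasurable]

/-- A background diagonal block as an `ℝ≥0∞` integral: for `0 ≤ m ≤ M_b` measurable and continuous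
`a`, `∫_{Λⁿ} m(xⱼ)|a|² = (∫⁻ m(xⱼ)‖a‖₊²).toReal`. [folklore] -/
theorem diag_background_eq_toReal {m : Space → ℝ} (hm : Measurable m) (hm0 : ∀ y, 0 ≤ m y)
    {Mb : ℝ} (hMb : ∀ y, |m y| ≤ Mb) (j : Fin n) {a : Config n → ℂ} (ha : Continuous a) :
    ∫ X in cellN n ℓ, m (X j) * ‖a X‖ ^ 2 =
      (∫⁻ X in cellN n ℓ, ENNReal.ofReal (m (X j)) * (‖a X‖₊ : ℝ≥0∞) ^ 2).toReal := by
  have hmj : Measurable fun X : Config n => m (X j) := hm.comp (measurable_pi_apply j)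
  have hMb0 : 0 ≤ Mb := (abs_nonneg _).trans (hMb 0)
  obtain ⟨C, hC⟩ := (isCompact_closedCubeN n ℓ).exists_bound_of_continuousOn ha.continuousOn
  have hint : IntegrableOn (fun X => m (X j) * ‖a X‖ ^ 2) (cellN n ℓ) := by
    refine integrableOn_cellN_of_bounded (hmj.mul (ha.measurable.norm.pow_const 2)) (C := Mb * C ^ 2)
      fun X hX => ?_
    rw [Real.norm_eq_abs, abs_mul, abs_of_nonneg (sq_nonneg ‖a X‖)]
    exact mul_le_mul (hMb _) (pow_le_pow_left₀ (norm_nonneg _)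
      (hC X (cellN_subset_closedCubeN n ℓ hX)) 2) (sq_nonneg _) hMb0
  rw [integral_eq_lintegral_of_nonneg_ae (Eventually.of_forall fun X => mul_nonneg (hm0 _) (sq_nonneg _))
    hint.aestronglyMeasurable]
  congr 1
  refine lintegral_congr fun X => ?_
  rw [ENNReal.ofReal_mul (hm0 _), ← ofReal_norm_sq_eq]

/-- The background cross term is majorized by `∫⁻ m‖a‖₊‖b‖₊`: for `0 ≤ m ≤ M_b` measurable and
continuous `a, b`, `|∫_{Λⁿ} m(xⱼ) Re(conj(a) b)| ≤ (∫⁻ m(xⱼ)‖a‖₊‖b‖₊).toReal`. [folklore] -/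
theorem abs_background_cross_le_toReal {m : Space → ℝ} (hm : Measurable m) (hm0 : ∀ y, 0 ≤ m y)
    {Mb : ℝ} (hMb : ∀ y, |m y| ≤ Mb) (j : Fin n) {a b : Config n → ℂ} (ha : Continuous a)
    (hb : Continuous b) :
    |∫ X in cellN n ℓ, m (X j) * (conj (a X) * b X).re| ≤
      (∫⁻ X in cellN n ℓ, ENNReal.ofReal (m (X j)) * ((‖a X‖₊ : ℝ≥0∞) * ‖b X‖₊)).toReal := by
  -- reduce to the pair-weight statement with the weight `w(x,y) = m(x)` (constant in `y`)
  have hw : Measurable (Function.uncurry fun (x _ : Space) => m x) := hm.comp measurable_fst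
  have h := abs_offdiag_block_le_toReal (ℓ := ℓ) (w := fun x _ => m x) hw (fun x _ => hm0 x)
    (fun x _ => hMb x) j j ha hb
  simpa only using h

end Literature.MathematicalPhysics.QuantumManyBody.JelliumBoseGas
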